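import Summits.CriticalPhenomena.SAWScalingLimit.Theses.SAWDevelopingMap
import Summits.CriticalPhenomena.SAWScalingLimit.Theorems.SAWDevelopingMapInteriorFlatteningLiouvilleBulkNoFoldSlit
import Summits.CriticalPhenomena.SAWScalingLimit.Theorems.SAWDevelopingMapInteriorFlatteningLiouvilleEquivalence

/-!
# BIRTH skeleton for child 1 `BulkNoFold` of the split of `InteriorFlattening` (stmt-CriticalPhenomena-8297)

Redirect strategist r1 (`planner-cstrat-stmt-CriticalPhenomena-8297-r1-0`, 2026-08-17). BC3 material for the child once the split
`InteriorFlattening ⇐ BulkNoFold ∧ LocalLimitsUnique` is applied on route SAWDevelopingMap: 2 named stubs and a kernel-checked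
composition `BulkNoFold_of` concluding the CHILD TEXT (route vocabulary; definitionally `∃ k R₀, 0 ≤ k ∧ k < 1 ∧ RatioAtDepth R₀ k`).

The cut follows the landed equivalence `BulkNoFold.bulkNoFold_iff_deepSlitCoherence` (…LiouvilleBulkNoFoldSlit) and the diagnosis of
the sibling crux `NoFoldBound` (Cruxes/NoFoldBound/NOTES.md: `noFoldBound_iff_sourceLoopBound_and_slitCoherence`, p92354; the interior
stratum needs (i) a termwise returning-loop bound at slit tips and (ii) phase coherence of the first-arrival port amplitudes):

* `stub_deepReturnLoopBound`        — (i) at DEPTH: a rooted critical-SAP inequality — the `x_c`-mass `Z_γ` of returning loops of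
                                       `(Λ ∖ γ) ∖ v` between the two free ports of an `R₁`-deep vertex `v`, for every first arrival `γ`
                                       at the third port, is `≤ z₀ < sin(π/8)` uniformly (threshold of the support item SourceLoopBound,
                                       stmt-8300; numerically `Z ≤ 0.08–0.12`, margin 3×; print frontier `p_N ≤ Cμ^N N^{-1/2}`). OPEN.
* `stub_deepCoherenceGivenLoopBound` — (ii) at DEPTH, HARDEST: given the termwise bound `z₀`, some `k < 1` bounds the Beltrami quotient
                                       at every `R₂`-deep vertex — no `ℤ/3`-polarised cancellation of the dressed first-arrival sums
                                       (82.5°- vs 37.5°-character of one positive winding law). OPEN (W-type at one depth).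
* `BulkNoFold_of`                    — stub₁ → stub₂ → CHILD TEXT at depth `max R₁ R₂` (pure logic + `deep_anti`; no sorry).

Sorries: exactly the two `stub_*`.
-/

noncomputable section

open scoped BigOperators Topology
open Filter Literature.Probability.LatticeModels Literature.Probability.RandomPlanarGeometry.SAW

namespace Summit.CriticalPhenomena.SAWScalingLimit.Cruxes.BulkNoFold.Birth

open Summit.CriticalPhenomena.SAWScalingLimit.Theorems.InteriorFlattening.Liouville

/-- Termwise returning-loop bound `z₀` at the vertex `v` of `(Λ, a)`: for every port `w` of `v`, every first arrival `γ : a → {v,w}`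
not through `v`, and the two other ports `p, q`, the critical returning-loop mass of `((Λ ∖ γ) ∖ v)` from `{v,p}` to `{v,q}` is `≤ z₀`. -/
def LoopBoundAt (z₀ : ℝ) (Λ : Finset HexVertex) (a : Sym2 HexVertex) (v : HexVertex) : Prop :=
  ∀ w p q : HexVertex, hexGraph.Adj v w → hexGraph.Adj v p → hexGraph.Adj v q → w ≠ p → p ≠ q → w ≠ q →
    ∀ γ : HexMidEdgeSAW Λ a s(v, w), v ∉ γ.verts →
      (∑ δ : HexMidEdgeSAW ((Λ \ γ.verts.toFinset).erase v) s(v, p) s(v, q), hexCriticalFugacity ^ δ.length) ≤ z₀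

/-- **stub 1 — returning-loop bound at deep slit tips (rooted critical-SAP inequality; OPEN).** There are `z₀ < sin(π/8)` and a
depth `R₁` such that `LoopBoundAt z₀ Λ a v` holds at every `R₁`-deep vertex `v` of every simply connected `Λ` with boundary root `a`.
Why plausibly true: `Z ≤ 0.081` observed (card), `≈ 0.12` worst admissible (NoFoldBound lead), smallest loop `x_c^5 = 0.046`,
threshold `sin(π/8) = 0.3827`; the DCS sum rule gives `Z ≲ 0.92` rigorously (half-plane `≤ 1/x_c`). Size: open-problem as an
absolute constant (needs `p_N ≤ Cμ^N N^{-2-ε}`-type control of rooted polygons; print frontier `N^{-1/2}`), possibly M/L at large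
depth if depth can be traded for the loop's minimal length. -/
theorem stub_deepReturnLoopBound :
    ∃ z₀ : ℝ, z₀ < Real.sin (Real.pi / 8) ∧ ∃ R₁ : ℝ,
      ∀ (Λ : Finset HexVertex), hexDomainSimplyConnected Λ → ∀ a ∈ hexDomainBoundary Λ, ∀ v ∈ Λ,
        Deep Λ v R₁ → LoopBoundAt z₀ Λ a v := by
  sorry

/-- **stub 2 — first-arrival coherence at depth, given the loop bound (HARDEST; OPEN).** For every termwise bound `z₀ < sin(π/8)`
there are `k < 1` and a depth `R₂` such that at every `R₂`-deep vertex satisfying `LoopBoundAt z₀`, in every frame,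
`‖F₀ + ωF₁ + ω²F₂‖ ≤ k ‖F₀ + F₁ + F₂‖`. By `interior_modes` (landed for stmt-8296) this is the dressed slit-coherence inequality
`‖Σ_j ω^j Σ_γ c_γ(β_T + √3 x Z_γ)‖ ≤ k ‖Σ_j Σ_γ c_γ(α_T − √3 x Z_γ)‖` with every dressed source triple individually non-folding
(`dressed_le`, p98850): what remains is the absence of `ℤ/3`-polarised cancellation across the three ports. Why plausibly true:
sup quotient `0.40 → 0.21` (R = 2 → 4.6, exact), amplification by far fields `≤ 1.09`. Size: open-problem (W at one depth). -/
theorem stub_deepCoherenceGivenLoopBound :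
    ∀ z₀ : ℝ, z₀ < Real.sin (Real.pi / 8) → ∃ k R₂ : ℝ, 0 ≤ k ∧ k < 1 ∧
      ∀ (Λ : Finset HexVertex), hexDomainSimplyConnected Λ → ∀ a ∈ hexDomainBoundary Λ, ∀ v ∈ Λ,
        Deep Λ v R₂ → LoopBoundAt z₀ Λ a v →
        ∀ w₀ w₁ w₂ : HexVertex, hexGraph.Adj v w₀ → hexGraph.Adj v w₁ → hexGraph.Adj v w₂ →
          w₀ ≠ w₁ → w₁ ≠ w₂ → w₀ ≠ w₂ →
            ‖fieldBelt (obs Λ a) v w₀ w₁ w₂‖ ≤ k * ‖fieldMono (obs Λ a) v w₀ w₁ w₂‖ := by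
  sorry

/-- The child text (route vocabulary) is definitionally the Defs-side bulk no-fold. -/
theorem child_iff_defs :
    (∃ k R₀ : ℝ, 0 ≤ k ∧ k < 1 ∧ ∀ (Λ : Finset Literature.Probability.LatticeModels.HexVertex), Literature.Probability.RandomPlanarGeometry.SAW.hexDomainSimplyConnected Λ → ∀ a ∈ Literature.Probability.RandomPlanarGeometry.SAW.hexDomainBoundary Λ, ∀ v ∈ Λ, (∀ w : Literature.Probability.LatticeModels.HexVertex, dist (Literature.Probability.LatticeModels.hexCenter w) (Literature.Probability.LatticeModels.hexCenter v) ≤ R₀ → w ∈ Λ) → ∀ w₀ w₁ w₂ : Literature.Probability.LatticeModels.HexVertex, Literature.Probability.LatticeModels.hexGraph.Adj v w₀ → Literature.Probability.LatticeModels.hexGraph.Adj v w₁ → Literature.Probability.LatticeModels.hexGraph.Adj v w₂ → w₀ ≠ w₁ → w₁ ≠ w₂ → w₀ ≠ w₂ → let F : Sym2 Literature.Probability.LatticeModels.HexVertex → ℂ := Literature.Probability.RandomPlanarGeometry.SAW.hexParafermionicObservable Λ a Literature.Probability.RandomPlanarGeometry.SAW.hexCriticalFugacity (5 / 8); let ω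 : ℂ := Complex.exp (2 * Real.pi * Complex.I / 3); ‖F s(v, w₀) + ω * F s(v, w₁) + ω ^ 2 * F s(v, w₂)‖ ≤ k * ‖F s(v, w₀) + F s(v, w₁) + F s(v, w₂)‖) ↔ (∃ k R₀ : ℝ, 0 ≤ k ∧ k < 1 ∧ RatioAtDepth R₀ k) :=
  Iff.rfl

/-- **COMPOSITION — the two stubs give the CHILD TEXT** at depth `max R₁ R₂` (no sorry). -/
theorem BulkNoFold_of
    (h₁ : ∃ z₀ : ℝ, z₀ < Real.sin (Real.pi / 8) ∧ ∃ R₁ : ℝ,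
      ∀ (Λ : Finset HexVertex), hexDomainSimplyConnected Λ → ∀ a ∈ hexDomainBoundary Λ, ∀ v ∈ Λ,
        Deep Λ v R₁ → LoopBoundAt z₀ Λ a v)
    (h₂ : ∀ z₀ : ℝ, z₀ < Real.sin (Real.pi / 8) → ∃ k R₂ : ℝ, 0 ≤ k ∧ k < 1 ∧
      ∀ (Λ : Finset HexVertex), hexDomainSimplyConnected Λ → ∀ a ∈ hexDomainBoundary Λ, ∀ v ∈ Λ,
        Deep Λ v R₂ → LoopBoundAt z₀ Λ a v →
        ∀ w₀ w₁ w₂ : HexVertex, hexGraph.Adj v w₀ → hexGraph.Adj v w₁ → hexGraph.Adj v w₂ →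
          w₀ ≠ w₁ → w₁ ≠ w₂ → w₀ ≠ w₂ →
            ‖fieldBelt (obs Λ a) v w₀ w₁ w₂‖ ≤ k * ‖fieldMono (obs Λ a) v w₀ w₁ w₂‖) :
    (∃ k R₀ : ℝ, 0 ≤ k ∧ k < 1 ∧ ∀ (Λ : Finset Literature.Probability.LatticeModels.HexVertex), Literature.Probability.RandomPlanarGeometry.SAW.hexDomainSimplyConnected Λ → ∀ a ∈ Literature.Probability.RandomPlanarGeometry.SAW.hexDomainBoundary Λ, ∀ v ∈ Λ, (∀ w : Literature.Probability.LatticeModels.HexVertex, dist (Literature.Probability.LatticeModels.hexCenter w) (Literature.Probability.LatticeModels.hexCenter v) ≤ R₀ → w ∈ Λ) → ∀ w₀ w₁ w₂ : Literature.Probability.LatticeModels.HexVertex, Literature.Probability.LatticeModels.hexGraph.Adj v w₀ → Literature.Probability.LatticeModels.hexGraph.Adj v w₁ → Literature.Probability.LatticeModels.hexGraph.Adj v w₂ → w₀ ≠ w₁ → w₁ ≠ w₂ → w₀ ≠ w₂ → let F : Sym2 Literature.Probability.LatticeModels.HexVertex → ℂ := Literature.Probability.RandomPlanarGeometry.SAW.hexParafermionicObservable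 Λ a Literature.Probability.RandomPlanarGeometry.SAW.hexCriticalFugacity (5 / 8); let ω : ℂ := Complex.exp (2 * Real.pi * Complex.I / 3); ‖F s(v, w₀) + ω * F s(v, w₁) + ω ^ 2 * F s(v, w₂)‖ ≤ k * ‖F s(v, w₀) + F s(v, w₁) + F s(v, w₂)‖) := by
  obtain ⟨z₀, hz₀, R₁, hL⟩ := h₁
  obtain ⟨k, R₂, hk0, hk1, hC⟩ := h₂ z₀ hz₀
  refine child_iff_defs.2 ⟨k, max R₁ R₂, hk0, hk1, ?_⟩
  intro Λ hΛ a ha v hv hdeep w₀ w₁ w₂ h₀ h₁' h₂' h01 h12 h02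
  exact hC Λ hΛ a ha v hv (BulkNoFold.deep_anti hdeep (le_max_right _ _))
    (hL Λ hΛ a ha v hv (BulkNoFold.deep_anti hdeep (le_max_left _ _))) w₀ w₁ w₂ h₀ h₁' h₂' h01 h12 h02

/-- The child is implied by the sibling crux `NoFoldBound` (stmt-CriticalPhenomena-8296) — it closes automatically if (K) does. -/
theorem child_of_noFoldBound (hK : Summit.CriticalPhenomena.SAWScalingLimit.Theses.SAWDevelopingMap.NoFoldBound) :
    (∃ k R₀ : ℝ, 0 ≤ k ∧ k < 1 ∧ ∀ (Λ : Finset Literature.Probability.LatticeModels.HexVertex), Literature.Probability.RandomPlanarGeometry.SAW.hexDomainSimplyConnected Λ → ∀ a ∈ Literature.Probability.RandomPlanarGeometry.SAW.hexDomainBoundary Λ, ∀ v ∈ Λ, (∀ w : Literature.Probability.LatticeModels.HexVertex, dist (Literature.Probability.LatticeModels.hexCenter w) (Literature.Probability.LatticeModels.hexCenter v) ≤ R₀ → w ∈ Λ) → ∀ w₀ w₁ w₂ : Literature.Probability.LatticeModels.HexVertex, Literature.Probability.LatticeModels.hexGraph.Adj v w₀ → Literature.Probability.LatticeModels.hexGraph.Adj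 v w₁ → Literature.Probability.LatticeModels.hexGraph.Adj v w₂ → w₀ ≠ w₁ → w₁ ≠ w₂ → w₀ ≠ w₂ → let F : Sym2 Literature.Probability.LatticeModels.HexVertex → ℂ := Literature.Probability.RandomPlanarGeometry.SAW.hexParafermionicObservable Λ a Literature.Probability.RandomPlanarGeometry.SAW.hexCriticalFugacity (5 / 8); let ω : ℂ := Complex.exp (2 * Real.pi * Complex.I / 3); ‖F s(v, w₀) + ω * F s(v, w₁) + ω ^ 2 * F s(v, w₂)‖ ≤ k * ‖F s(v, w₀) + F s(v, w₁) + F s(v, w₂)‖) :=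
  child_iff_defs.2 (BulkNoFold.bulkNoFold_of_noFoldBound hK)

/-- The child is NECESSARY for the parent crux (M). -/
theorem child_of_interiorFlattening
    (h : Summit.CriticalPhenomena.SAWScalingLimit.Theses.SAWDevelopingMap.InteriorFlattening) : (∃ k R₀ : ℝ, 0 ≤ k ∧ k < 1 ∧ ∀ (Λ : Finset Literature.Probability.LatticeModels.HexVertex), Literature.Probability.RandomPlanarGeometry.SAW.hexDomainSimplyConnected Λ → ∀ a ∈ Literature.Probability.RandomPlanarGeometry.SAW.hexDomainBoundary Λ, ∀ v ∈ Λ, (∀ w : Literature.Probability.LatticeModels.HexVertex, dist (Literature.Probability.LatticeModels.hexCenter w) (Literature.Probability.LatticeModels.hexCenter v) ≤ R₀ → w ∈ Λ) → ∀ w₀ w₁ w₂ : Literature.Probability.LatticeModels.HexVertex, Literature.Probability.LatticeModels.hexGraph.Adj v w₀ → Literature.Probability.LatticeModels.hexGraph.Adj v w₁ → Literature.Probability.LatticeModels.hexGraph.Adj v w₂ → w₀ ≠ w₁ → w₁ ≠ w₂ → w₀ ≠ w₂ → let F : Sym2 Literature.Probability.LatticeModels.HexVertex → ℂ := Literature.Probability.RandomPlanarGeometry.SAW.hexParafermionicObservable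 Λ a Literature.Probability.RandomPlanarGeometry.SAW.hexCriticalFugacity (5 / 8); let ω : ℂ := Complex.exp (2 * Real.pi * Complex.I / 3); ‖F s(v, w₀) + ω * F s(v, w₁) + ω ^ 2 * F s(v, w₂)‖ ≤ k * ‖F s(v, w₀) + F s(v, w₁) + F s(v, w₂)‖) :=
  child_iff_defs.2 (BulkNoFold.bulkNoFold_of_interiorFlattening h)

/-- The child from the two registered stubs (documentation of closure; carries the two sorries). -/
theorem BulkNoFold_of_stubs : (∃ k R₀ : ℝ, 0 ≤ k ∧ k < 1 ∧ ∀ (Λ : Finset Literature.Probability.LatticeModels.HexVertex), Literature.Probability.RandomPlanarGeometry.SAW.hexDomainSimplyConnected Λ → ∀ a ∈ Literature.Probability.RandomPlanarGeometry.SAW.hexDomainBoundary Λ, ∀ v ∈ Λ, (∀ w : Literature.Probability.LatticeModels.HexVertex, dist (Literature.Probability.LatticeModels.hexCenter w) (Literature.Probability.LatticeModels.hexCenter v) ≤ R₀ → w ∈ Λ) → ∀ w₀ w₁ w₂ : Literature.Probability.LatticeModels.HexVertex, Literature.Probability.LatticeModels.hexGraph.Adj v w₀ → Literature.Probability.LatticeModels.hexGraph.Adj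 v w₁ → Literature.Probability.LatticeModels.hexGraph.Adj v w₂ → w₀ ≠ w₁ → w₁ ≠ w₂ → w₀ ≠ w₂ → let F : Sym2 Literature.Probability.LatticeModels.HexVertex → ℂ := Literature.Probability.RandomPlanarGeometry.SAW.hexParafermionicObservable Λ a Literature.Probability.RandomPlanarGeometry.SAW.hexCriticalFugacity (5 / 8); let ω : ℂ := Complex.exp (2 * Real.pi * Complex.I / 3); ‖F s(v, w₀) + ω * F s(v, w₁) + ω ^ 2 * F s(v, w₂)‖ ≤ k * ‖F s(v, w₀) + F s(v, w₁) + F s(v, w₂)‖) :=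
  BulkNoFold_of stub_deepReturnLoopBound stub_deepCoherenceGivenLoopBound

end Summit.CriticalPhenomena.SAWScalingLimit.Cruxes.BulkNoFold.Birth

end
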